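import Literature.Analysis.FluidPDE.Tao2016AveragedNS.RestartedCascadeFlows
import HarnessLib

/-!
# Tao 2016, §4 and §6 with the SHIFT SET AS A PARAMETER: cascade flows on `S♭` (cell vocabulary)

T. Tao, *Finite time blowup for an averaged three-dimensional Navier–Stokes equation*, J. Amer.
Math. Soc. **29** (2016) 601–674 = arXiv:1402.0290v3 [`Tao2016AveragedNS`]: §4 (the shift set `S`
after (4.1), symmetry (4.2), cancellation (4.3), Lemma 4.1 (4.5)–(4.11), Theorem 4.2) and §6.2–6.4
(Props. 6.3–6.5). Tao's cascade couples a wavelet to "at most one child" (p. 9 footnote 7 and the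
display after (4.1)): the structure constants live on the ONE-WAY nearest-neighbour shift set
`S = {(0,0,0),(1,0,0),(0,1,0),(0,0,1)}`. The Euler bilinear form, Littlewood–Paley localised to
adjacent dyadic shells, also contains the three «backscatter» classes `(1,1,0), (1,0,1), (0,1,1)`
(two inputs on the upper shell, output on the lower one), which Tao's averaging switches off.

This module (definition request of cell harvest/h2-tao-ladder, planner theory-1 g14; source: the
cell's definition sketch `numT21/M2FlatSketch.lean`, sha16 cfb2fd01bb4cbf44, referee cycle 34 ruling
R-21 ADOPT) re-states the tree's cascade vocabulary (`TaoCascadeODE`, `LocalCascadeSolutions`,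
`RestartedCascadeFlows`) with the shift set as an explicit PARAMETER `𝕊 : Finset (ℤ × ℤ × ℤ)`:

* `shiftSetFlat` — the nearest-neighbour two-way shift set `S♭ = S ∪ {(1,1,0),(1,0,1),(0,1,1)}`
  (the seven classes of `{0,1}³` modulo common translation, `(1,1,1) ≡ (0,0,0)`);
* `quadTermOn 𝕊` — the nonlinearity (4.8) summed over `𝕊` (`quadTermOn shiftSet = quadTerm`, `rfl`);
* `IsSymmetricCoeffOn 𝕊` / `IsCancellingCoeffOn 𝕊` / `IsComparableCoeffOn 𝕊 R` / `InTableClassOn 𝕊 R`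
  — (4.2), (4.3) and the cell's comparability class on `𝕊` (tables supported on `𝕊`);
* `CascadeODESolutionFromOn 𝕊` (global) and `CascadeODESolutionOnShift 𝕊 T` (local on `[0,T]`) —
  the conclusions (4.5)–(4.10) of Lemma 4.1 WITHOUT (4.11): with backscatter present the shells below
  the datum shell are fed, so "no very low frequencies" is no longer a consequence of the dynamics
  (the two-sided a priori decay (4.5) still controls them); `NoGlobalCascadeOn 𝕊`;
* the restart vocabulary of `RestartedCascadeFlows` over `𝕊`: `PseudoFlowOnShift 𝕊`,
  `DynamicsLocalAtOn 𝕊` (any number `m` of modes), `FrontExistsOn 𝕊`, `RobustStepOn 𝕊`,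
  `GapDataOn 𝕊`, `StepSlackOn 𝕊`, `GapData₂On 𝕊` (the table-free clauses `ballDesc`, `TailFat`,
  `TameBehind`, `TailCompat`, `TailThin`, `StepTo`, `EpochCheckpoints`, `slackWeight` are the tree's);
* bridges at `𝕊 = shiftSet`: every `…On shiftSet` notion implies / is implied by the tree's notion
  (`rfl`-level), so nothing proved over `S` is duplicated.

NAMING CAVEAT (referee c30 R12′ / c34 C6): the rung «M₂^{S♭}» these notions serve is NOT the older cell label
«M₂♭» = `RungTwoFlatLatt` (the interior-point sub-claim of route TaoLadderRungTwoBreak), which keeps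
its name. The rung CLAIMS themselves («M₂^{S♭}» = the sketch's `TargetM2Flat` — one spread `C ≥ 1`,
every small `ε₀`, SOME `C`-comparable table on `S♭` with `NoGlobalCascadeOn shiftSetFlat ε₀ α X₀` — and
«M₃^{S♭}», its dyadic `ε₀ = 1` form) are NOT vendored here: like `RungTwoLatt` they are route items
(`Target` of `Theses/TaoLadderRungTwoFlat.lean`), spelled over this module. MODEL lattice objects only
— nothing in this module is a statement about the Navier–Stokes equations; every `def … : Prop` is a
PREDICATE with parameters, none is asserted.
-/

noncomputable section

open Set MeasureTheory intervalIntegral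

namespace Literature.Analysis.FluidPDE

namespace TaoCascade

/-! ### The two-way nearest-neighbour shift set `S♭` -/

/-- The nearest-neighbour two-way shift set `S♭ = S ∪ {(1,1,0),(1,0,1),(0,1,1)}`: all seven classes of
`{0,1}³` modulo common translation (`(1,1,1) ≡ (0,0,0)`). The three added classes are the
«backscatter» triads (two inputs on the upper shell, output on the lower shell) that Tao's one-way
topology switches off. [cite: Tao2016AveragedNS, §4 after (4.1) (the shift set S) and p. 9 footnote 7 (the all-children variant); cell vocabulary, shift-set parametrised] -/
def shiftSetFlat : Finset (ℤ × ℤ × ℤ) :=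
  {(0, 0, 0), (1, 0, 0), (0, 1, 0), (0, 0, 1), (1, 1, 0), (1, 0, 1), (0, 1, 1)}

/-- Membership in `S♭`, unfolded. [cite: Tao2016AveragedNS, §4 after (4.1); cell vocabulary, shift-set parametrised] -/
theorem mem_shiftSetFlat_iff (μ : ℤ × ℤ × ℤ) :
    μ ∈ shiftSetFlat ↔ μ = (0, 0, 0) ∨ μ = (1, 0, 0) ∨ μ = (0, 1, 0) ∨ μ = (0, 0, 1) ∨
      μ = (1, 1, 0) ∨ μ = (1, 0, 1) ∨ μ = (0, 1, 1) := by
  simp [shiftSetFlat]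

/-- `S ⊆ S♭`. [cite: Tao2016AveragedNS, §4 after (4.1); cell vocabulary, shift-set parametrised] -/
theorem shiftSet_subset_shiftSetFlat : shiftSet ⊆ shiftSetFlat := by
  intro μ hμ
  rcases (mem_shiftSet_iff μ).1 hμ with h | h | h | h <;> subst h <;> simp [shiftSetFlat]

/-- `S♭` has seven elements. [cite: Tao2016AveragedNS, §4 after (4.1); cell vocabulary, shift-set parametrised] -/
theorem card_shiftSetFlat : shiftSetFlat.card = 7 := by
  decide

/-- The backscatter class `(1,1,0)` lies in `S♭` but not in `S`.
[cite: Tao2016AveragedNS, §4 after (4.1); cell vocabulary, shift-set parametrised] -/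
theorem backscatter_mem_shiftSetFlat_not_mem_shiftSet :
    ((1 : ℤ), (1 : ℤ), (0 : ℤ)) ∈ shiftSetFlat ∧ ((1 : ℤ), (1 : ℤ), (0 : ℤ)) ∉ shiftSet := by
  refine ⟨by simp [shiftSetFlat], ?_⟩
  simp [shiftSet]

/-! ### Structure constants and the nonlinearity on a shift set `𝕊` -/

/-- The quadratic cascade nonlinearity (4.8) with the shift set `S` replaced by the parameter `𝕊`
(same clock `(1+ε₀)^{5(n-μ₃)/2}` attached to the triad's base shell `n - μ₃`).
[cite: Tao2016AveragedNS, §4 (4.8); cell vocabulary, shift-set parametrised] -/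
def quadTermOn (𝕊 : Finset (ℤ × ℤ × ℤ)) (ε₀ : ℝ) {m : ℕ}
    (α : Fin m → Fin m → Fin m → ℤ × ℤ × ℤ → ℝ) (X : Fin m → ℤ → ℝ → ℝ) (i : Fin m) (n : ℤ)
    (t : ℝ) : ℝ :=
  ∑ i₁ : Fin m, ∑ i₂ : Fin m, ∑ μ ∈ 𝕊,
    α i₁ i₂ i μ * (1 + ε₀) ^ ((5 : ℝ) * (n - μ.2.2) / 2) *
      (X i₁ (n - μ.2.2 + μ.1) t * X i₂ (n - μ.2.2 + μ.2.1) t)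

/-- On `S` the parametrised nonlinearity is the tree's `quadTerm`, definitionally.
[cite: Tao2016AveragedNS, §4 (4.8); cell vocabulary, shift-set parametrised] -/
theorem quadTermOn_shiftSet (ε₀ : ℝ) {m : ℕ} (α : Fin m → Fin m → Fin m → ℤ × ℤ × ℤ → ℝ)
    (X : Fin m → ℤ → ℝ → ℝ) (i : Fin m) (n : ℤ) (t : ℝ) :
    quadTermOn shiftSet ε₀ α X i n t = quadTerm ε₀ α X i n t := rfl

/-- Symmetry (4.2) on the shift set `𝕊`. [cite: Tao2016AveragedNS, §4 (4.2); cell vocabulary, shift-set parametrised] -/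
def IsSymmetricCoeffOn (𝕊 : Finset (ℤ × ℤ × ℤ)) {m : ℕ}
    (α : Fin m → Fin m → Fin m → ℤ × ℤ × ℤ → ℝ) : Prop :=
  ∀ (i₁ i₂ i₃ : Fin m) (μ₁ μ₂ μ₃ : ℤ), (μ₁, μ₂, μ₃) ∈ 𝕊 →
    α i₁ i₂ i₃ (μ₁, μ₂, μ₃) = α i₂ i₁ i₃ (μ₂, μ₁, μ₃)

/-- Cancellation (4.3) on the shift set `𝕊` (sum over the six slot permutations).
[cite: Tao2016AveragedNS, §4 (4.3); cell vocabulary, shift-set parametrised] -/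
def IsCancellingCoeffOn (𝕊 : Finset (ℤ × ℤ × ℤ)) {m : ℕ}
    (α : Fin m → Fin m → Fin m → ℤ × ℤ × ℤ → ℝ) : Prop :=
  ∀ (i₁ i₂ i₃ : Fin m) (μ₁ μ₂ μ₃ : ℤ), (μ₁, μ₂, μ₃) ∈ 𝕊 →
    α i₁ i₂ i₃ (μ₁, μ₂, μ₃) + α i₁ i₃ i₂ (μ₁, μ₃, μ₂) + α i₂ i₁ i₃ (μ₂, μ₁, μ₃) +
      α i₂ i₃ i₁ (μ₂, μ₃, μ₁) + α i₃ i₁ i₂ (μ₃, μ₁, μ₂) + α i₃ i₂ i₁ (μ₃, μ₂, μ₁) = 0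

/-- `R`-comparability on `𝕊`: every entry on `𝕊` has modulus `≤ 1` and is either `0` or `≥ R⁻¹` in
modulus, AND the table is supported on `𝕊` (entries off `𝕊` vanish — they never enter `quadTermOn 𝕊`).
[cite: Tao2016AveragedNS, §6.1 (6.1)–(6.4) (the table being compared); cell vocabulary, shift-set parametrised] -/
def IsComparableCoeffOn (𝕊 : Finset (ℤ × ℤ × ℤ)) (R : ℝ) {m : ℕ}
    (α : Fin m → Fin m → Fin m → ℤ × ℤ × ℤ → ℝ) : Prop :=
  (∀ (i₁ i₂ i₃ : Fin m) (μ : ℤ × ℤ × ℤ), μ ∈ 𝕊 →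
    |α i₁ i₂ i₃ μ| ≤ 1 ∧ (α i₁ i₂ i₃ μ = 0 ∨ R⁻¹ ≤ |α i₁ i₂ i₃ μ|)) ∧
  ∀ (i₁ i₂ i₃ : Fin m) (μ : ℤ × ℤ × ℤ), μ ∉ 𝕊 → α i₁ i₂ i₃ μ = 0

/-- The table class `E(𝕊, R)`: symmetric, cancelling, `R`-comparable, supported on `𝕊`.
[cite: Tao2016AveragedNS, §4 (4.2)–(4.3); cell vocabulary, shift-set parametrised] -/
def InTableClassOn (𝕊 : Finset (ℤ × ℤ × ℤ)) (R : ℝ) {m : ℕ}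
    (α : Fin m → Fin m → Fin m → ℤ × ℤ × ℤ → ℝ) : Prop :=
  IsSymmetricCoeffOn 𝕊 α ∧ IsCancellingCoeffOn 𝕊 α ∧ IsComparableCoeffOn 𝕊 R α

/-- On `S`, symmetry on the parameter is the tree's (4.2). [cite: Tao2016AveragedNS, §4 (4.2); cell vocabulary, shift-set parametrised] -/
theorem isSymmetricCoeffOn_shiftSet_iff {m : ℕ} (α : Fin m → Fin m → Fin m → ℤ × ℤ × ℤ → ℝ) :
    IsSymmetricCoeffOn shiftSet α ↔ IsSymmetricCoeff α := Iff.rfl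

/-- On `S`, cancellation on the parameter is the tree's (4.3). [cite: Tao2016AveragedNS, §4 (4.3); cell vocabulary, shift-set parametrised] -/
theorem isCancellingCoeffOn_shiftSet_iff {m : ℕ} (α : Fin m → Fin m → Fin m → ℤ × ℤ × ℤ → ℝ) :
    IsCancellingCoeffOn shiftSet α ↔ IsCancellingCoeff α := Iff.rfl

/-- On `S`, comparability on the parameter (with support) implies the tree's comparability.
[cite: Tao2016AveragedNS, §6.1; cell vocabulary, shift-set parametrised] -/
theorem IsComparableCoeffOn.isComparableCoeff {R : ℝ} {m : ℕ}
    {α : Fin m → Fin m → Fin m → ℤ × ℤ × ℤ → ℝ} (h : IsComparableCoeffOn shiftSet R α) :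
    IsComparableCoeff R α :=
  fun i₁ i₂ i₃ μ hμ => h.1 i₁ i₂ i₃ μ hμ

/-- On `S`, the parametrised table class implies the tree's class `InTableClass`.
[cite: Tao2016AveragedNS, §4 (4.2)–(4.3); cell vocabulary, shift-set parametrised] -/
theorem InTableClassOn.inTableClass {R : ℝ} {m : ℕ}
    {α : Fin m → Fin m → Fin m → ℤ × ℤ × ℤ → ℝ} (h : InTableClassOn shiftSet R α) :
    InTableClass R α :=
  ⟨(isSymmetricCoeffOn_shiftSet_iff α).1 h.1, (isCancellingCoeffOn_shiftSet_iff α).1 h.2.1,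
    h.2.2.isComparableCoeff⟩

/-- Comparability on `𝕊` is monotone in the spread. [cite: Tao2016AveragedNS, §6.1; cell vocabulary, shift-set parametrised] -/
theorem IsComparableCoeffOn.mono {𝕊 : Finset (ℤ × ℤ × ℤ)} {R R' : ℝ} {m : ℕ}
    {α : Fin m → Fin m → Fin m → ℤ × ℤ × ℤ → ℝ} (h : IsComparableCoeffOn 𝕊 R α) (hR : 0 < R)
    (hRR' : R ≤ R') : IsComparableCoeffOn 𝕊 R' α := by
  refine ⟨fun i₁ i₂ i₃ μ hμ => ?_, h.2⟩
  obtain ⟨h1, h2⟩ := h.1 i₁ i₂ i₃ μ hμ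
  exact ⟨h1, h2.imp_right fun h3 => (inv_anti₀ hR hRR').trans h3⟩

/-! ### The conclusions (4.5)–(4.10) of Lemma 4.1 on a shift set, without (4.11) -/

/-- **Global pseudo-solutions on the shift set `𝕊`** from the one-shell datum `u₀ = ∑ᵢ X₀ᵢ ψ_{i,n₀}`:
the conclusions (4.5)–(4.10) of Lemma 4.1 (`CascadeODESolutionFrom` with `quadTerm` replaced by
`quadTermOn 𝕊`) WITHOUT (4.11) — with backscatter present the shells below `n₀` are fed; the
two-sided decay (4.5) still controls them.
[cite: Tao2016AveragedNS, §4 Lemma 4.1 (4.5)–(4.10) (statement shape); cell vocabulary, shift-set parametrised] -/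
structure CascadeODESolutionFromOn (𝕊 : Finset (ℤ × ℤ × ℤ)) (ε₀ : ℝ) {m : ℕ}
    (α : Fin m → Fin m → Fin m → ℤ × ℤ × ℤ → ℝ) (K₁ K₂ : ℝ) (n₀ : ℤ) (X₀ : Fin m → ℝ)
    (X E : Fin m → ℤ → ℝ → ℝ) : Prop where
  /-- `X_{i,n}` is continuously differentiable on `[0,+∞)`. -/
  contDiffOn_X : ∀ i n, ContDiffOn ℝ 1 (X i n) (Ici 0)
  /-- `E_{i,n}` is continuously differentiable on `[0,+∞)`. -/
  contDiffOn_E : ∀ i n, ContDiffOn ℝ 1 (E i n) (Ici 0)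
  /-- `E_{i,n} ≥ 0` on `[0,+∞)`. -/
  nonneg_E : ∀ i n t, 0 ≤ t → 0 ≤ E i n t
  /-- (4.5), coefficients. -/
  apriori_X : ∀ T : ℝ, 0 < T → ∃ M : ℝ, ∀ t ∈ Icc 0 T, ∀ (i : Fin m) (n : ℤ),
    (1 + (1 + ε₀) ^ ((10 : ℝ) * n)) * |X i n t| ≤ M
  /-- (4.5), energies. -/
  apriori_E : ∀ T : ℝ, 0 < T → ∃ M : ℝ, ∀ t ∈ Icc 0 T, ∀ (i : Fin m) (n : ℤ),
    (1 + (1 + ε₀) ^ ((10 : ℝ) * n)) * Real.sqrt (E i n t) ≤ M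
  /-- (4.6). -/
  init_E : ∀ i n, E i n 0 = (1 / 2) * X i n 0 ^ 2
  /-- (4.7) for the one-shell datum `X₀`. -/
  init_X : ∀ i n, X i n 0 = if n = n₀ then X₀ i else 0
  /-- (4.8) with the nonlinearity summed over `𝕊`. -/
  motion : ∀ i n t, 0 ≤ t →
    |derivWithin (X i n) (Ici 0) t - quadTermOn 𝕊 ε₀ α X i n t| ≤
      K₁ * (1 + ε₀) ^ ((2 : ℝ) * n) * Real.sqrt (E i n t)
  /-- (4.9) with the nonlinearity summed over `𝕊`. -/
  energy : ∀ i n t, 0 ≤ t →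
    derivWithin (E i n) (Ici 0) t ≤ quadTermOn 𝕊 ε₀ α X i n t * X i n t
  /-- (4.10), lower. -/
  defect_lower : ∀ i n t, 0 ≤ t → (1 / 2) * X i n t ^ 2 ≤ E i n t
  /-- (4.10), upper. -/
  defect_upper : ∀ i n t, 0 ≤ t →
    E i n t ≤ (1 / 2) * X i n t ^ 2 + K₂ * (1 + ε₀) ^ ((2 : ℝ) * n) * ∫ s in (0 : ℝ)..t, E i n s

/-- A Tao-format global pseudo-solution (on `S`, with (4.11)) is one in the `𝕊 = S` format without
(4.11). [cite: Tao2016AveragedNS, §4 Lemma 4.1 (4.5)–(4.11); cell vocabulary, shift-set parametrised] -/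
theorem CascadeODESolutionFrom.toFromOn {ε₀ : ℝ} {m : ℕ}
    {α : Fin m → Fin m → Fin m → ℤ × ℤ × ℤ → ℝ} {K₁ K₂ : ℝ} {n₀ : ℤ} {X₀ : Fin m → ℝ}
    {X E : Fin m → ℤ → ℝ → ℝ} (h : CascadeODESolutionFrom ε₀ α K₁ K₂ n₀ X₀ X E) :
    CascadeODESolutionFromOn shiftSet ε₀ α K₁ K₂ n₀ X₀ X E where
  contDiffOn_X := h.contDiffOn_X
  contDiffOn_E := h.contDiffOn_E
  nonneg_E := h.nonneg_E
  apriori_X := h.apriori_X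
  apriori_E := h.apriori_E
  init_E := h.init_E
  init_X := h.init_X
  motion := h.motion
  energy := h.energy
  defect_lower := h.defect_lower
  defect_upper := h.defect_upper

/-- **Local pseudo-solutions on the shift set `𝕊` on `[0,T]`**: the conclusions (4.5)–(4.10) of
Lemma 4.1 on a finite horizon (`CascadeODESolutionOn` with `quadTermOn 𝕊`, every time hypothesis
`t ∈ [0,T]`, one-sided derivatives within `[0,T]`) WITHOUT (4.11). Local solutions exist for every
table, so statements quantified over them are not vacuous.
[cite: Tao2016AveragedNS, §4 Lemma 4.1 (4.5)–(4.10) (statement shape); cell vocabulary, shift-set parametrised] -/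
structure CascadeODESolutionOnShift (𝕊 : Finset (ℤ × ℤ × ℤ)) (T ε₀ : ℝ) {m : ℕ}
    (α : Fin m → Fin m → Fin m → ℤ × ℤ × ℤ → ℝ) (K₁ K₂ : ℝ) (n₀ : ℤ) (X₀ : Fin m → ℝ)
    (X E : Fin m → ℤ → ℝ → ℝ) : Prop where
  /-- `X_{i,n}` is continuously differentiable on `[0,T]`. -/
  contDiffOn_X : ∀ i n, ContDiffOn ℝ 1 (X i n) (Icc 0 T)
  /-- `E_{i,n}` is continuously differentiable on `[0,T]`. -/
  contDiffOn_E : ∀ i n, ContDiffOn ℝ 1 (E i n) (Icc 0 T)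
  /-- `E_{i,n} ≥ 0` on `[0,T]`. -/
  nonneg_E : ∀ i n t, t ∈ Icc 0 T → 0 ≤ E i n t
  /-- (4.5), coefficients, on `[0,T]`. -/
  apriori_X : ∃ M : ℝ, ∀ t ∈ Icc 0 T, ∀ (i : Fin m) (n : ℤ),
    (1 + (1 + ε₀) ^ ((10 : ℝ) * n)) * |X i n t| ≤ M
  /-- (4.5), energies, on `[0,T]`. -/
  apriori_E : ∃ M : ℝ, ∀ t ∈ Icc 0 T, ∀ (i : Fin m) (n : ℤ),
    (1 + (1 + ε₀) ^ ((10 : ℝ) * n)) * Real.sqrt (E i n t) ≤ M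
  /-- (4.6). -/
  init_E : ∀ i n, E i n 0 = (1 / 2) * X i n 0 ^ 2
  /-- (4.7) for the one-shell datum `X₀`. -/
  init_X : ∀ i n, X i n 0 = if n = n₀ then X₀ i else 0
  /-- (4.8) on `[0,T]` with the nonlinearity summed over `𝕊`. -/
  motion : ∀ i n t, t ∈ Icc 0 T →
    |derivWithin (X i n) (Icc 0 T) t - quadTermOn 𝕊 ε₀ α X i n t| ≤
      K₁ * (1 + ε₀) ^ ((2 : ℝ) * n) * Real.sqrt (E i n t)
  /-- (4.9) on `[0,T]` with the nonlinearity summed over `𝕊`. -/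
  energy : ∀ i n t, t ∈ Icc 0 T →
    derivWithin (E i n) (Icc 0 T) t ≤ quadTermOn 𝕊 ε₀ α X i n t * X i n t
  /-- (4.10), lower, on `[0,T]`. -/
  defect_lower : ∀ i n t, t ∈ Icc 0 T → (1 / 2) * X i n t ^ 2 ≤ E i n t
  /-- (4.10), upper, on `[0,T]`. -/
  defect_upper : ∀ i n t, t ∈ Icc 0 T →
    E i n t ≤ (1 / 2) * X i n t ^ 2 + K₂ * (1 + ε₀) ^ ((2 : ℝ) * n) * ∫ s in (0 : ℝ)..t, E i n s

/-- A Tao-format local pseudo-solution (on `S`, with (4.11)) is one in the `𝕊 = S` format without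
(4.11). [cite: Tao2016AveragedNS, §4 Lemma 4.1 (4.5)–(4.11); cell vocabulary, shift-set parametrised] -/
theorem CascadeODESolutionOn.toShift {T ε₀ : ℝ} {m : ℕ}
    {α : Fin m → Fin m → Fin m → ℤ × ℤ × ℤ → ℝ} {K₁ K₂ : ℝ} {n₀ : ℤ} {X₀ : Fin m → ℝ}
    {X E : Fin m → ℤ → ℝ → ℝ} (h : CascadeODESolutionOn T ε₀ α K₁ K₂ n₀ X₀ X E) :
    CascadeODESolutionOnShift shiftSet T ε₀ α K₁ K₂ n₀ X₀ X E where
  contDiffOn_X := h.contDiffOn_X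
  contDiffOn_E := h.contDiffOn_E
  nonneg_E := h.nonneg_E
  apriori_X := h.apriori_X
  apriori_E := h.apriori_E
  init_E := h.init_E
  init_X := h.init_X
  motion := h.motion
  energy := h.energy
  defect_lower := h.defect_lower
  defect_upper := h.defect_upper

/-- **Global ⇒ local on `𝕊`**: a global pseudo-solution on `𝕊` restricts to a local one on every
`[0,T]`, `T > 0`. [cite: Tao2016AveragedNS, §4 Lemma 4.1 (4.5)–(4.10); cell vocabulary, shift-set parametrised] -/
theorem CascadeODESolutionFromOn.restrict {𝕊 : Finset (ℤ × ℤ × ℤ)} {ε₀ : ℝ} {m : ℕ}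
    {α : Fin m → Fin m → Fin m → ℤ × ℤ × ℤ → ℝ} {K₁ K₂ : ℝ} {n₀ : ℤ} {X₀ : Fin m → ℝ}
    {X E : Fin m → ℤ → ℝ → ℝ} (h : CascadeODESolutionFromOn 𝕊 ε₀ α K₁ K₂ n₀ X₀ X E)
    {T : ℝ} (hT : 0 < T) : CascadeODESolutionOnShift 𝕊 T ε₀ α K₁ K₂ n₀ X₀ X E where
  contDiffOn_X i n := (h.contDiffOn_X i n).mono Icc_subset_Ici_self
  contDiffOn_E i n := (h.contDiffOn_E i n).mono Icc_subset_Ici_self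
  nonneg_E i n t ht := h.nonneg_E i n t ht.1
  apriori_X := h.apriori_X T hT
  apriori_E := h.apriori_E T hT
  init_E := h.init_E
  init_X := h.init_X
  motion i n t ht := by
    rw [derivWithin_Icc_eq_derivWithin_Ici (h.contDiffOn_X i n) hT ht]
    exact h.motion i n t ht.1
  energy i n t ht := by
    rw [derivWithin_Icc_eq_derivWithin_Ici (h.contDiffOn_E i n) hT ht]
    exact h.energy i n t ht.1
  defect_lower i n t ht := h.defect_lower i n t ht.1
  defect_upper i n t ht := h.defect_upper i n t ht.1

/-- **No global pseudo-solution on the shift set `𝕊`** for the table `α`, ratio `1+ε₀`, datum `X₀`: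
for all implied constants and all large `n₀` no global family obeys (4.5)–(4.10) on `𝕊`
("Theorem 4.2-level blow-up" on `𝕊`). [cite: Tao2016AveragedNS, §4 Thm. 4.2 (statement shape); cell vocabulary, shift-set parametrised] -/
def NoGlobalCascadeOn (𝕊 : Finset (ℤ × ℤ × ℤ)) (ε₀ : ℝ) {m : ℕ}
    (α : Fin m → Fin m → Fin m → ℤ × ℤ × ℤ → ℝ) (X₀ : Fin m → ℝ) : Prop :=
  ∀ K₁ K₂ : ℝ, 0 ≤ K₁ → 0 ≤ K₂ → ∃ N₀ : ℤ, ∀ n₀ : ℤ, N₀ ≤ n₀ →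
    ¬ ∃ X E : Fin m → ℤ → ℝ → ℝ, CascadeODESolutionFromOn 𝕊 ε₀ α K₁ K₂ n₀ X₀ X E

/-- On `S` the parametrised blow-up statement implies the tree's `NoGlobalCascade` (fewer families
to exclude there, (4.11) being an extra constraint). [cite: Tao2016AveragedNS, §4 Thm. 4.2 (statement shape); cell vocabulary, shift-set parametrised] -/
theorem NoGlobalCascadeOn.noGlobalCascade {ε₀ : ℝ} {m : ℕ}
    {α : Fin m → Fin m → Fin m → ℤ × ℤ × ℤ → ℝ} {X₀ : Fin m → ℝ}
    (h : NoGlobalCascadeOn shiftSet ε₀ α X₀) : NoGlobalCascade ε₀ α X₀ := by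
  intro K₁ K₂ hK₁ hK₂
  obtain ⟨N₀, hN₀⟩ := h K₁ K₂ hK₁ hK₂
  refine ⟨N₀, fun n₀ hn₀ => ?_⟩
  rintro ⟨X, E, hXE⟩
  exact hN₀ n₀ hn₀ ⟨X, E, hXE.toFromOn⟩

/-! ### Restarted pseudo-flows, front steps and gap data on a shift set `𝕊` -/

/-- **A restarted local pseudo-flow on `[0, τ]` on the shift set `𝕊`**: `PseudoFlowOn` with the
nonlinearity `quadTermOn 𝕊` (displays (4.5), (4.8)–(4.10) at level `0`, amplitude `1`, defect
constants `κ₁, κ₂`, arbitrary start state `(S₀, F₀)`, accumulated (4.10)-slack `B₀`).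
[cite: Tao2016AveragedNS, §4 Lemma 4.1 (4.5), (4.8)–(4.10) and §6.4 Prop. 6.5 (i), (ii), (iv) (statement shape); cell vocabulary, shift-set parametrised] -/
structure PseudoFlowOnShift (𝕊 : Finset (ℤ × ℤ × ℤ)) (τ ε₀ : ℝ) {m : ℕ}
    (α : Fin m → Fin m → Fin m → ℤ × ℤ × ℤ → ℝ) (κ₁ κ₂ : ℝ) (S₀ F₀ B₀ : Fin m → ℤ → ℝ)
    (S F : Fin m → ℤ → ℝ → ℝ) : Prop where
  /-- `S_{i,k}` is continuously differentiable on `[0,τ]`. -/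
  contDiffOn_S : ∀ i k, ContDiffOn ℝ 1 (S i k) (Icc 0 τ)
  /-- `F_{i,k}` is continuously differentiable on `[0,τ]`. -/
  contDiffOn_F : ∀ i k, ContDiffOn ℝ 1 (F i k) (Icc 0 τ)
  /-- `F_{i,k} ≥ 0` on `[0,τ]`. -/
  nonneg_F : ∀ i k s, s ∈ Icc 0 τ → 0 ≤ F i k s
  /-- (4.5), amplitudes, on `[0,τ]` (qualitative). -/
  apriori_S : ∃ M : ℝ, ∀ s ∈ Icc 0 τ, ∀ (i : Fin m) (k : ℤ),
    (1 + (1 + ε₀) ^ ((10 : ℝ) * k)) * |S i k s| ≤ M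
  /-- (4.5), energies, on `[0,τ]` (qualitative). -/
  apriori_F : ∃ M : ℝ, ∀ s ∈ Icc 0 τ, ∀ (i : Fin m) (k : ℤ),
    (1 + (1 + ε₀) ^ ((10 : ℝ) * k)) * Real.sqrt (F i k s) ≤ M
  /-- start state, amplitudes. -/
  init_S : ∀ i k, S i k 0 = S₀ i k
  /-- start state, energies. -/
  init_F : ∀ i k, F i k 0 = F₀ i k
  /-- (4.8) with defect constant `κ₁`, nonlinearity over `𝕊`. -/
  motion : ∀ i k s, s ∈ Icc 0 τ →
    |derivWithin (S i k) (Icc 0 τ) s - quadTermOn 𝕊 ε₀ α S i k s| ≤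
      κ₁ * (1 + ε₀) ^ ((2 : ℝ) * k) * Real.sqrt (F i k s)
  /-- (4.9), nonlinearity over `𝕊`. -/
  energy : ∀ i k s, s ∈ Icc 0 τ →
    derivWithin (F i k) (Icc 0 τ) s ≤ quadTermOn 𝕊 ε₀ α S i k s * S i k s
  /-- (4.10), lower. -/
  defect_lower : ∀ i k s, s ∈ Icc 0 τ → (1 / 2) * S i k s ^ 2 ≤ F i k s
  /-- (4.10), upper, with the accumulated slack `B₀` and defect constant `κ₂`. -/
  defect_upper : ∀ i k s, s ∈ Icc 0 τ →
    F i k s ≤ (1 / 2) * S i k s ^ 2 + B₀ i k +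
      κ₂ * (1 + ε₀) ^ ((2 : ℝ) * k) * ∫ u in (0 : ℝ)..s, F i k u

/-- On `S`, the tree's restarted pseudo-flows are pseudo-flows on the parameter `𝕊 = S`.
[cite: Tao2016AveragedNS, §4 Lemma 4.1 and §6.4 Prop. 6.5 (statement shape); cell vocabulary, shift-set parametrised] -/
theorem PseudoFlowOn.toShift {τ ε₀ : ℝ} {m : ℕ} {α : Fin m → Fin m → Fin m → ℤ × ℤ × ℤ → ℝ}
    {κ₁ κ₂ : ℝ} {S₀ F₀ B₀ : Fin m → ℤ → ℝ} {S F : Fin m → ℤ → ℝ → ℝ}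
    (h : PseudoFlowOn τ ε₀ α κ₁ κ₂ S₀ F₀ B₀ S F) : PseudoFlowOnShift shiftSet τ ε₀ α κ₁ κ₂ S₀ F₀ B₀ S F where
  contDiffOn_S := h.contDiffOn_S
  contDiffOn_F := h.contDiffOn_F
  nonneg_F := h.nonneg_F
  apriori_S := h.apriori_S
  apriori_F := h.apriori_F
  init_S := h.init_S
  init_F := h.init_F
  motion := h.motion
  energy := h.energy
  defect_lower := h.defect_lower
  defect_upper := h.defect_upper

/-- On `S`, pseudo-flows on the parameter `𝕊 = S` are the tree's restarted pseudo-flows.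
[cite: Tao2016AveragedNS, §4 Lemma 4.1 and §6.4 Prop. 6.5 (statement shape); cell vocabulary, shift-set parametrised] -/
theorem PseudoFlowOnShift.toPseudoFlowOn {τ ε₀ : ℝ} {m : ℕ}
    {α : Fin m → Fin m → Fin m → ℤ × ℤ × ℤ → ℝ} {κ₁ κ₂ : ℝ} {S₀ F₀ B₀ : Fin m → ℤ → ℝ}
    {S F : Fin m → ℤ → ℝ → ℝ} (h : PseudoFlowOnShift shiftSet τ ε₀ α κ₁ κ₂ S₀ F₀ B₀ S F) :
    PseudoFlowOn τ ε₀ α κ₁ κ₂ S₀ F₀ B₀ S F where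
  contDiffOn_S := h.contDiffOn_S
  contDiffOn_F := h.contDiffOn_F
  nonneg_F := h.nonneg_F
  apriori_S := h.apriori_S
  apriori_F := h.apriori_F
  init_S := h.init_S
  init_F := h.init_F
  motion := h.motion
  energy := h.energy
  defect_lower := h.defect_lower
  defect_upper := h.defect_upper

/-- `PseudoFlowOnShift shiftSet` and `PseudoFlowOn` are the same predicate.
[cite: Tao2016AveragedNS, §4 Lemma 4.1 and §6.4 Prop. 6.5 (statement shape); cell vocabulary, shift-set parametrised] -/
theorem pseudoFlowOnShift_shiftSet_iff {τ ε₀ : ℝ} {m : ℕ}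
    {α : Fin m → Fin m → Fin m → ℤ × ℤ × ℤ → ℝ} {κ₁ κ₂ : ℝ} {S₀ F₀ B₀ : Fin m → ℤ → ℝ}
    {S F : Fin m → ℤ → ℝ → ℝ} :
    PseudoFlowOnShift shiftSet τ ε₀ α κ₁ κ₂ S₀ F₀ B₀ S F ↔ PseudoFlowOn τ ε₀ α κ₁ κ₂ S₀ F₀ B₀ S F :=
  ⟨PseudoFlowOnShift.toPseudoFlowOn, PseudoFlowOn.toShift⟩

/-- **`DynamicsLocalAtOn 𝕊 ε₀ R` — the local robust checkpoint induction at ONE scale ratio `1+ε₀`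
for the comparable class `E(𝕊, R)`** with ANY number `m` of modes: `DynamicsLocalAt` with
`InTableClassOn 𝕊`, local pseudo-solutions `CascadeODESolutionOnShift 𝕊` (no (4.11)) and `m`
existentially quantified. (base) `P` at the rescaled datum; (step) epoch checkpoints extend by one
level along every local pseudo-solution whose next lifespan fits in the horizon. A predicate on
`(𝕊, ε₀, R)`; nothing is asserted.
[cite: Tao2016AveragedNS, §6.2–6.3 Props. 6.3–6.4 (statement shape); cell vocabulary, shift-set parametrised] -/
def DynamicsLocalAtOn (𝕊 : Finset (ℤ × ℤ × ℤ)) (ε₀ R : ℝ) : Prop :=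
  ∃ (m : ℕ) (θ c : ℝ) (i₀ : Fin m) (α : Fin m → Fin m → Fin m → ℤ × ℤ × ℤ → ℝ) (X₀ : Fin m → ℝ)
    (P Q : (Fin m → ℤ → ℝ) → (Fin m → ℤ → ℝ) → Prop),
    0 ≤ θ ∧ θ < 5 / 2 ∧ 0 < c ∧ InTableClassOn 𝕊 R α ∧ X₀ i₀ ≠ 0 ∧
      P (datumState i₀ X₀) (datumEnergy i₀ X₀) ∧
      ∀ K₁ K₂ : ℝ, 0 ≤ K₁ → 0 ≤ K₂ → ∃ N₀ : ℤ, ∀ n₀ : ℤ, N₀ ≤ n₀ →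
        ∀ T : ℝ, 0 < T → ∀ X E : Fin m → ℤ → ℝ → ℝ,
          CascadeODESolutionOnShift 𝕊 T ε₀ α K₁ K₂ n₀ X₀ X E →
            ∀ N : ℤ, n₀ ≤ N → ∀ t e : ℤ → ℝ, EpochCheckpoints ε₀ θ c i₀ n₀ X₀ P Q N X E t e →
              t N + c * (1 + ε₀) ^ (-(5 : ℝ) * N / 2) * (e N)⁻¹ ≤ T →
                ∃ s a : ℝ, EpochCheckpoints ε₀ θ c i₀ n₀ X₀ P Q (N + 1) X E
                  (Function.update t (N + 1) s) (Function.update e (N + 1) a)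

/-- **(front) on `𝕊`** — from every admissible start state a DEFECT-FREE flow on `𝕊` exists on the
whole clock window `[0, c]` (`FrontExists` with `PseudoFlowOnShift 𝕊`).
[cite: Tao2016AveragedNS, §4 Lemma 4.1 (4.5), (4.8)–(4.10) (displays); cell vocabulary, shift-set parametrised] -/
def FrontExistsOn (𝕊 : Finset (ℤ × ℤ × ℤ)) (ε₀ θ c η : ℝ) {m : ℕ}
    (α : Fin m → Fin m → Fin m → ℤ × ℤ × ℤ → ℝ) (P : (Fin m → ℤ → ℝ) → (Fin m → ℤ → ℝ) → Prop)
    (env : ℤ → ℝ) : Prop :=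
  ∀ (L : ℕ) (S₀ F₀ B₀ : Fin m → ℤ → ℝ), P S₀ F₀ →
    (∀ i k, 0 ≤ B₀ i k ∧ B₀ i k ≤ η * slackWeight ε₀ θ c env L k) →
    (∀ i k, (1 / 2) * S₀ i k ^ 2 ≤ F₀ i k ∧ F₀ i k ≤ (1 / 2) * S₀ i k ^ 2 + B₀ i k) →
      ∃ S F : Fin m → ℤ → ℝ → ℝ, PseudoFlowOnShift 𝕊 c ε₀ α 0 0 S₀ F₀ B₀ S F

/-- **(step) on `𝕊`** — every `(η, η)`-pseudo-flow on `𝕊` from an admissible start state steps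
(`RobustStep` with `PseudoFlowOnShift 𝕊`).
[cite: Tao2016AveragedNS, §6.4 Prop. 6.5 (statement shape); cell vocabulary, shift-set parametrised] -/
def RobustStepOn (𝕊 : Finset (ℤ × ℤ × ℤ)) (ε₀ θ c η : ℝ) {m : ℕ} (i₀ : Fin m)
    (α : Fin m → Fin m → Fin m → ℤ × ℤ × ℤ → ℝ) (P : (Fin m → ℤ → ℝ) → (Fin m → ℤ → ℝ) → Prop)
    (env : ℤ → ℝ) : Prop :=
  ∀ (L : ℕ) (S₀ F₀ B₀ : Fin m → ℤ → ℝ), P S₀ F₀ →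
    (∀ i k, 0 ≤ B₀ i k ∧ B₀ i k ≤ η * slackWeight ε₀ θ c env L k) →
      ∀ τ : ℝ, c ≤ τ → ∀ S F : Fin m → ℤ → ℝ → ℝ,
        PseudoFlowOnShift 𝕊 τ ε₀ α η η S₀ F₀ B₀ S F →
          ∃ τ₁ a : ℝ, StepTo ε₀ θ c i₀ P (epochEnvelope env) S F τ₁ a

/-- On `S`, `FrontExistsOn shiftSet` is the tree's `FrontExists`.
[cite: Tao2016AveragedNS, §4 Lemma 4.1 (displays); cell vocabulary, shift-set parametrised] -/
theorem frontExistsOn_shiftSet_iff {ε₀ θ c η : ℝ} {m : ℕ}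
    {α : Fin m → Fin m → Fin m → ℤ × ℤ × ℤ → ℝ} {P : (Fin m → ℤ → ℝ) → (Fin m → ℤ → ℝ) → Prop}
    {env : ℤ → ℝ} : FrontExistsOn shiftSet ε₀ θ c η α P env ↔ FrontExists ε₀ θ c η α P env := by
  refine ⟨fun h L S₀ F₀ B₀ hP hB hF => ?_, fun h L S₀ F₀ B₀ hP hB hF => ?_⟩
  · obtain ⟨S, F, hSF⟩ := h L S₀ F₀ B₀ hP hB hF
    exact ⟨S, F, hSF.toPseudoFlowOn⟩
  · obtain ⟨S, F, hSF⟩ := h L S₀ F₀ B₀ hP hB hF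
    exact ⟨S, F, hSF.toShift⟩

/-- On `S`, `RobustStepOn shiftSet` is the tree's `RobustStep`.
[cite: Tao2016AveragedNS, §6.4 Prop. 6.5 (statement shape); cell vocabulary, shift-set parametrised] -/
theorem robustStepOn_shiftSet_iff {ε₀ θ c η : ℝ} {m : ℕ} {i₀ : Fin m}
    {α : Fin m → Fin m → Fin m → ℤ × ℤ × ℤ → ℝ} {P : (Fin m → ℤ → ℝ) → (Fin m → ℤ → ℝ) → Prop}
    {env : ℤ → ℝ} : RobustStepOn shiftSet ε₀ θ c η i₀ α P env ↔ RobustStep ε₀ θ c η i₀ α P env := by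
  refine ⟨fun h L S₀ F₀ B₀ hP hB τ hτ S F hSF => ?_, fun h L S₀ F₀ B₀ hP hB τ hτ S F hSF => ?_⟩
  · exact h L S₀ F₀ B₀ hP hB τ hτ S F hSF.toShift
  · exact h L S₀ F₀ B₀ hP hB τ hτ S F hSF.toPseudoFlowOn

/-- **GAP DATA on `𝕊`** at scale ratio `1+ε₀`: `GapData` with the defect-free flows of (exist₀) and
(step₀) taken on `𝕊` (signs and margins, weights `w ≥ 1`, datum in `Z`, the tail clause `TailFat`,
existence on the clock window from the `r`-ball, and the exact zero-slack step into the `ρ r`-ball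
within the clock `c₀` with ratio `≥ (1+ε₀)^{-θ₀}` and energies under `env₀`). The SHAPE of a
renormalisation certificate for one table on `𝕊`; nothing is asserted.
[cite: Tao2016AveragedNS, §6.3–6.4 Props. 6.4–6.5 (statement shape); cell vocabulary, shift-set parametrised] -/
def GapDataOn (𝕊 : Finset (ℤ × ℤ × ℤ)) (ε₀ : ℝ) {m : ℕ} (i₀ : Fin m)
    (α : Fin m → Fin m → Fin m → ℤ × ℤ × ℤ → ℝ) (X₀ : Fin m → ℝ) (Z : Set (Fin m → ℤ → ℝ))
    (w : ℤ → ℝ) (r ρ θ₀ θ c₀ c : ℝ) (env₀ : ℤ → ℝ) : Prop :=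
  0 < r ∧ 0 ≤ ρ ∧ ρ < 1 ∧ 0 ≤ θ₀ ∧ θ₀ < θ ∧ θ ≤ 1 / 2 ∧ 0 < c₀ ∧ c₀ < c ∧ (∀ k, 1 ≤ w k) ∧
    datumState i₀ X₀ ∈ Z ∧ TailFat ε₀ Z w r ∧
    (∀ S₀ : Fin m → ℤ → ℝ, ballDesc Z w r S₀ (fun i k => (1 / 2) * S₀ i k ^ 2) →
      ∃ S F : Fin m → ℤ → ℝ → ℝ,
        PseudoFlowOnShift 𝕊 c ε₀ α 0 0 S₀ (fun i k => (1 / 2) * S₀ i k ^ 2) (fun _ _ => 0) S F) ∧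
    ∀ (S₀ : Fin m → ℤ → ℝ) (τ : ℝ) (S F : Fin m → ℤ → ℝ → ℝ),
      ballDesc Z w r S₀ (fun i k => (1 / 2) * S₀ i k ^ 2) → c₀ ≤ τ →
        PseudoFlowOnShift 𝕊 τ ε₀ α 0 0 S₀ (fun i k => (1 / 2) * S₀ i k ^ 2) (fun _ _ => 0) S F →
          ∃ τ₁ a : ℝ, StepTo ε₀ θ₀ c₀ i₀ (ballDesc Z w (ρ * r)) (epochEnvelope env₀) S F τ₁ a

/-- The sign and margin conjuncts of gap data on `𝕊`.
[cite: Tao2016AveragedNS, §6.3–6.4 (statement shape); cell vocabulary, shift-set parametrised] -/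
theorem GapDataOn.signs {𝕊 : Finset (ℤ × ℤ × ℤ)} {ε₀ : ℝ} {m : ℕ} {i₀ : Fin m}
    {α : Fin m → Fin m → Fin m → ℤ × ℤ × ℤ → ℝ} {X₀ : Fin m → ℝ} {Z : Set (Fin m → ℤ → ℝ)}
    {w : ℤ → ℝ} {r ρ θ₀ θ c₀ c : ℝ} {env₀ : ℤ → ℝ}
    (h : GapDataOn 𝕊 ε₀ i₀ α X₀ Z w r ρ θ₀ θ c₀ c env₀) :
    0 < r ∧ 0 ≤ ρ ∧ ρ < 1 ∧ 0 ≤ θ₀ ∧ θ₀ < θ ∧ θ ≤ 1 / 2 ∧ 0 < c₀ ∧ c₀ < c ∧ ∀ k, 1 ≤ w k :=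
  ⟨h.1, h.2.1, h.2.2.1, h.2.2.2.1, h.2.2.2.2.1, h.2.2.2.2.2.1, h.2.2.2.2.2.2.1, h.2.2.2.2.2.2.2.1,
    h.2.2.2.2.2.2.2.2.1⟩

/-- Under gap data on `𝕊` every reference state (with any energies) is in the ball description.
[cite: Tao2016AveragedNS, §6.2 Prop. 6.3 (viii); cell vocabulary, shift-set parametrised] -/
theorem GapDataOn.datum_mem_ball {𝕊 : Finset (ℤ × ℤ × ℤ)} {ε₀ : ℝ} {m : ℕ} {i₀ : Fin m}
    {α : Fin m → Fin m → Fin m → ℤ × ℤ × ℤ → ℝ} {X₀ : Fin m → ℝ} {Z : Set (Fin m → ℤ → ℝ)}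
    {w : ℤ → ℝ} {r ρ θ₀ θ c₀ c : ℝ} {env₀ : ℤ → ℝ}
    (h : GapDataOn 𝕊 ε₀ i₀ α X₀ Z w r ρ θ₀ θ c₀ c env₀) (F : Fin m → ℤ → ℝ) :
    ballDesc Z w r (datumState i₀ X₀) F :=
  ballDesc_of_mem h.2.2.2.2.2.2.2.2.2.1 h.1.le F

/-- **AMPLITUDE SLACK `σ` IN THE EXACT STEP on `𝕊`** (`StepSlack` with `PseudoFlowOnShift 𝕊`).
[cite: Tao2016AveragedNS, §6.3–6.4 Props. 6.4–6.5 (statement shape); cell vocabulary, shift-set parametrised] -/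
def StepSlackOn (𝕊 : Finset (ℤ × ℤ × ℤ)) (σ ε₀ : ℝ) {m : ℕ} (i₀ : Fin m)
    (α : Fin m → Fin m → Fin m → ℤ × ℤ × ℤ → ℝ) (Z : Set (Fin m → ℤ → ℝ)) (w : ℤ → ℝ)
    (r ρ θ₀ c₀ : ℝ) (env₀ : ℤ → ℝ) : Prop :=
  ∀ (S₀ : Fin m → ℤ → ℝ) (τ : ℝ) (S F : Fin m → ℤ → ℝ → ℝ),
    ballDesc Z w r S₀ (fun i k => (1 / 2) * S₀ i k ^ 2) → c₀ ≤ τ →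
      PseudoFlowOnShift 𝕊 τ ε₀ α 0 0 S₀ (fun i k => (1 / 2) * S₀ i k ^ 2) (fun _ _ => 0) S F →
        ∃ τ₁ a : ℝ, StepTo ε₀ θ₀ c₀ i₀ (ballDesc Z w (ρ * r)) (epochEnvelope env₀) S F τ₁ a ∧
          (1 + σ) * a ≤ |S i₀ 1 τ₁|

/-- **GAP DATA, FORMAT v2, on `𝕊`** = `GapDataOn 𝕊` ∧ slack `σ > 0` ∧ `TameBehind` ∧ `StepSlackOn 𝕊`
∧ `TailCompat` (the table-free clauses are the tree's). The SHAPE of a certificate; nothing asserted.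
[cite: Tao2016AveragedNS, §6.3–6.4 Props. 6.4–6.5 (statement shape); cell vocabulary, shift-set parametrised, certificate format v2] -/
def GapData₂On (𝕊 : Finset (ℤ × ℤ × ℤ)) (σ ε₀ : ℝ) {m : ℕ} (i₀ : Fin m)
    (α : Fin m → Fin m → Fin m → ℤ × ℤ × ℤ → ℝ) (X₀ : Fin m → ℝ) (Z : Set (Fin m → ℤ → ℝ))
    (w : ℤ → ℝ) (r ρ θ₀ θ c₀ c : ℝ) (env₀ : ℤ → ℝ) : Prop :=
  GapDataOn 𝕊 ε₀ i₀ α X₀ Z w r ρ θ₀ θ c₀ c env₀ ∧ 0 < σ ∧ TameBehind ε₀ Z w ∧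
    StepSlackOn 𝕊 σ ε₀ i₀ α Z w r ρ θ₀ c₀ env₀ ∧ TailCompat ε₀ Z w r env₀

/-- v2 gap data on `𝕊` is v1 gap data on `𝕊`.
[cite: Tao2016AveragedNS, §6.3–6.4 (statement shape); cell vocabulary, shift-set parametrised, certificate format v2] -/
theorem GapData₂On.toGapDataOn {𝕊 : Finset (ℤ × ℤ × ℤ)} {σ ε₀ : ℝ} {m : ℕ} {i₀ : Fin m}
    {α : Fin m → Fin m → Fin m → ℤ × ℤ × ℤ → ℝ} {X₀ : Fin m → ℝ} {Z : Set (Fin m → ℤ → ℝ)}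
    {w : ℤ → ℝ} {r ρ θ₀ θ c₀ c : ℝ} {env₀ : ℤ → ℝ}
    (h : GapData₂On 𝕊 σ ε₀ i₀ α X₀ Z w r ρ θ₀ θ c₀ c env₀) :
    GapDataOn 𝕊 ε₀ i₀ α X₀ Z w r ρ θ₀ θ c₀ c env₀ := h.1

/-- The slack conjunct of v2 gap data on `𝕊`.
[cite: Tao2016AveragedNS, §6.3–6.4 (statement shape); cell vocabulary, shift-set parametrised, certificate format v2] -/
theorem GapData₂On.slack_pos {𝕊 : Finset (ℤ × ℤ × ℤ)} {σ ε₀ : ℝ} {m : ℕ} {i₀ : Fin m}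
    {α : Fin m → Fin m → Fin m → ℤ × ℤ × ℤ → ℝ} {X₀ : Fin m → ℝ} {Z : Set (Fin m → ℤ → ℝ)}
    {w : ℤ → ℝ} {r ρ θ₀ θ c₀ c : ℝ} {env₀ : ℤ → ℝ}
    (h : GapData₂On 𝕊 σ ε₀ i₀ α X₀ Z w r ρ θ₀ θ c₀ c env₀) : 0 < σ := h.2.1

/-- On `S`, gap data on the parameter `𝕊 = S` is the tree's `GapData`.
[cite: Tao2016AveragedNS, §6.3–6.4 (statement shape); cell vocabulary, shift-set parametrised] -/
theorem gapDataOn_shiftSet_iff {ε₀ : ℝ} {m : ℕ} {i₀ : Fin m}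
    {α : Fin m → Fin m → Fin m → ℤ × ℤ × ℤ → ℝ} {X₀ : Fin m → ℝ} {Z : Set (Fin m → ℤ → ℝ)}
    {w : ℤ → ℝ} {r ρ θ₀ θ c₀ c : ℝ} {env₀ : ℤ → ℝ} :
    GapDataOn shiftSet ε₀ i₀ α X₀ Z w r ρ θ₀ θ c₀ c env₀ ↔ GapData ε₀ i₀ α X₀ Z w r ρ θ₀ θ c₀ c env₀ := by
  simp only [GapDataOn, GapData, pseudoFlowOnShift_shiftSet_iff]

/-- On `S`, the exact step with slack on the parameter `𝕊 = S` is the tree's `StepSlack`.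
[cite: Tao2016AveragedNS, §6.3–6.4 (statement shape); cell vocabulary, shift-set parametrised, certificate format v2] -/
theorem stepSlackOn_shiftSet_iff {σ ε₀ : ℝ} {m : ℕ} {i₀ : Fin m}
    {α : Fin m → Fin m → Fin m → ℤ × ℤ × ℤ → ℝ} {Z : Set (Fin m → ℤ → ℝ)} {w : ℤ → ℝ}
    {r ρ θ₀ c₀ : ℝ} {env₀ : ℤ → ℝ} :
    StepSlackOn shiftSet σ ε₀ i₀ α Z w r ρ θ₀ c₀ env₀ ↔ StepSlack σ ε₀ i₀ α Z w r ρ θ₀ c₀ env₀ := by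
  simp only [StepSlackOn, StepSlack, pseudoFlowOnShift_shiftSet_iff]

/-- On `S`, v2 gap data on the parameter `𝕊 = S` is the tree's `GapData₂`.
[cite: Tao2016AveragedNS, §6.3–6.4 (statement shape); cell vocabulary, shift-set parametrised, certificate format v2] -/
theorem gapData₂On_shiftSet_iff {σ ε₀ : ℝ} {m : ℕ} {i₀ : Fin m}
    {α : Fin m → Fin m → Fin m → ℤ × ℤ × ℤ → ℝ} {X₀ : Fin m → ℝ} {Z : Set (Fin m → ℤ → ℝ)}
    {w : ℤ → ℝ} {r ρ θ₀ θ c₀ c : ℝ} {env₀ : ℤ → ℝ} :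
    GapData₂On shiftSet σ ε₀ i₀ α X₀ Z w r ρ θ₀ θ c₀ c env₀ ↔
      GapData₂ σ ε₀ i₀ α X₀ Z w r ρ θ₀ θ c₀ c env₀ := by
  simp only [GapData₂On, GapData₂, gapDataOn_shiftSet_iff, stepSlackOn_shiftSet_iff]

end TaoCascade

end Literature.Analysis.FluidPDE
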